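/-
Copyright: b2b-lace packet (carver, gen 14).  The TRAIL counts `a_n(x)` of [NoBLE17-I] §5.3.1
(walks that never use a bond twice) as a tree object in the step-word framework of
`Percolation/SusceptibilityPathCounting.lean`, with the inclusions SAW ⊆ trails ⊆ NBW
(LEMMAS §20 node N68a: `a_m(x) ≤ b_m(x)`).
-/
import Literature.Probability.Percolation.NonBacktrackingPathCounting
import HarnessLib

/-!
# Trails (bond-self-avoiding walks): `c_n(x) ≤ a_n(x) ≤ b_n(x)`

[NoBLE17-I] R. Fitzner, R. van der Hofstad, *Generalized approach to the non-backtracking lace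
expansion*, PTRF 169 (2017) 1041–1119, §5.3.1: "We define `a_n(x)` to be the number of `n`-step
simple random walk from `0` to `x` that never use a bond twice" (arXiv:1506.07969 TeX l.3100); the
bounds on simple diagrams ((5.19)–(5.27)) count percolation paths of exactly `m` bonds by
`G_{m̲,z}(x) ≤ (2d μ̄_z)^m c_m(x)` and longer pieces by `a_m` and `(2d μ̄_z)^m (a_m ⊗ G_z)(x)`.
The b2b-lace bound variant "NBW-kernel remainder" (LEMMAS §20 N53/N68) replaces the SRW majorant
`a_m ≤ (2d)^m D^{⋆m}` by the non-backtracking count `b_m` ("`a_m ≤ b_m`, trails ⊂ NBW").  The tree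
had self-avoiding (`IsSAW`, `sawWordsTo`: `c_n(x)`) and non-backtracking (`IsNBW`, `nbwWordsTo`:
`b_n(x)`) step words but no trail object.  This file supplies it:

* `IsTrail w` — the traversed bonds `{wordPos w k, wordPos w (k+1)}`, `k < n`, are pairwise distinct;
  `trailWords d n`, `trailWordsTo d n x` (`a_n = Σ_x a_n(x)`, `a_n(x)`).
* `IsTrail.isNBW` — an immediate reversal traverses one bond twice, so trails are non-backtracking;
  `isTrail_of_isSAW` — a self-avoiding walk never revisits a site, hence never reuses a bond.
* `sawWordsTo_subset_trailWordsTo`, `trailWordsTo_subset_nbwWordsTo` and the counting corollaries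
  `card_sawWordsTo_le_card_trailWordsTo` (`c_n(x) ≤ a_n(x)`), `card_trailWordsTo_le_card_nbwWordsTo`
  (`a_n(x) ≤ b_n(x)`), `card_trailWords_le` (`a_n ≤ 2d(2d-1)^{n-1}`).
* `IsTrail.card_wordEdges` — a trail of length `n` traverses exactly `n` distinct bonds.
-/

namespace Literature.Probability.FitznerVanDerHofstad2017

open Literature.Probability.Percolation Literature.Probability.LatticeModels Finset

variable {d : ℕ}

/-! ### Trails -/

/-- The `k`-th traversed bond `{wordPos w k, wordPos w (k+1)}` of a step word. [folklore] -/
def wordEdge {n : ℕ} (w : Fin n → Fin d × Bool) (k : ℕ) : Sym2 (Site d) :=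
  s(wordPos w k, wordPos w (k + 1))

/-- A step word is a **trail** (it "never uses a bond twice") if its traversed bonds are pairwise
distinct. [cite: FitznerVanDerHofstad2016NoBLE, §5.3.1 pp. 1096–1097 ("a_n(x) … the number of n-step simple random walk from 0 to x that never use a bond twice"; arXiv:1506.07969 TeX l.3100)] -/
def IsTrail {n : ℕ} (w : Fin n → Fin d × Bool) : Prop :=
  ∀ i j : ℕ, i < n → j < n → wordEdge w i = wordEdge w j → i = j

/-- **Trails are non-backtracking**: an immediate reversal `w_{k+1} = rev w_k` traverses the bond
`{wordPos w k, wordPos w (k+1)}` twice. [cite: MadrasSlade1993, §1.2 (walks with memory τ = 2)] -/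
theorem IsTrail.isNBW {n : ℕ} {w : Fin n → Fin d × Bool} (h : IsTrail w) : IsNBW w := by
  intro k hk hrev
  have hpos : wordPos w (k + 2) = wordPos w k := wordPos_add_two_of_srev w hk hrev
  have hedge : wordEdge w (k + 1) = wordEdge w k := by
    rw [wordEdge, wordEdge, show k + 1 + 1 = k + 2 from rfl, hpos, Sym2.eq_swap]
  have := h (k + 1) k hk (by omega) hedge
  omega

/-- **Self-avoiding walks are trails**: equal bonds share an endpoint, and a self-avoiding word
visits each site once. [cite: MadrasSlade1993, §1.2 (c_N ≤ c_{N,τ})] -/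
theorem isTrail_of_isSAW {n : ℕ} {w : Fin n → Fin d × Bool} (h : IsSAW w) : IsTrail w := by
  intro i j hi hj hij
  rw [wordEdge, wordEdge, Sym2.eq_iff] at hij
  rcases hij with ⟨h1, -⟩ | ⟨h1, h2⟩
  · exact h i j hi.le hj.le h1
  · have e1 := h i (j + 1) hi.le (by omega) h1
    have e2 := h (i + 1) j (by omega) hj.le h2
    omega

open Classical in
/-- The finite set of trails of length `n` (`a_n = Σ_x a_n(x)` of them).
[cite: FitznerVanDerHofstad2016NoBLE, §5.3.1 pp. 1096–1097 (a_n)] -/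
noncomputable def trailWords (d n : ℕ) : Finset (Fin n → Fin d × Bool) :=
  Finset.univ.filter fun w => IsTrail w

/-- Membership in `trailWords`. [folklore] -/
@[simp] theorem mem_trailWords {n : ℕ} {w : Fin n → Fin d × Bool} :
    w ∈ trailWords d n ↔ IsTrail w := by
  simp [trailWords]

open Classical in
/-- The trails of length `n` ending at `x` (`a_n(x)` of them).
[cite: FitznerVanDerHofstad2016NoBLE, §5.3.1 pp. 1096–1097 (a_n(x))] -/
noncomputable def trailWordsTo (d n : ℕ) (x : Site d) : Finset (Fin n → Fin d × Bool) :=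
  (trailWords d n).filter fun w => wordPos w n = x

/-- Membership in `trailWordsTo`. [folklore] -/
@[simp] theorem mem_trailWordsTo {n : ℕ} {w : Fin n → Fin d × Bool} {x : Site d} :
    w ∈ trailWordsTo d n x ↔ IsTrail w ∧ wordPos w n = x := by
  simp [trailWordsTo]

/-- `σ(n) ≤ a_n`: self-avoiding words are trails. [cite: MadrasSlade1993, §1.2 (c_N ≤ c_{N,τ})] -/
theorem sawWords_subset_trailWords (d n : ℕ) : sawWords d n ⊆ trailWords d n := fun _ hw =>
  mem_trailWords.2 (isTrail_of_isSAW (mem_sawWords.1 hw))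

/-- `a_n ≤ c_{n,2}`: trails are non-backtracking. [cite: MadrasSlade1993, §1.2 (memory τ = 2)] -/
theorem trailWords_subset_nbwWords (d n : ℕ) : trailWords d n ⊆ nbwWords d n := fun _ hw =>
  mem_nbwWords.2 (mem_trailWords.1 hw).isNBW

/-- `c_n(x) ≤ a_n(x)` as an inclusion. [cite: FitznerVanDerHofstad2016NoBLE, §5.3.1 pp. 1096–1097 (c_m(x), a_n(x))] -/
theorem sawWordsTo_subset_trailWordsTo (d n : ℕ) (x : Site d) :
    sawWordsTo d n x ⊆ trailWordsTo d n x := by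
  intro w hw
  rw [sawWordsTo, Finset.mem_filter] at hw
  exact mem_trailWordsTo.2 ⟨isTrail_of_isSAW (mem_sawWords.1 hw.1), hw.2⟩

/-- **`a_n(x) ≤ b_n(x)` as an inclusion** (trails ⊂ NBW; the input of the NBW-kernel remainder,
b2b-lace LEMMAS §20 N68a). [cite: FitznerVanDerHofstad2017, §2.4 ("such a connecting path is a non-backtracking walk")] -/
theorem trailWordsTo_subset_nbwWordsTo (d n : ℕ) (x : Site d) :
    trailWordsTo d n x ⊆ nbwWordsTo d n x := by
  intro w hw
  rw [nbwWordsTo, Finset.mem_filter]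
  have hw' := mem_trailWordsTo.1 hw
  exact ⟨mem_nbwWords.2 hw'.1.isNBW, hw'.2⟩

/-- `c_n(x) ≤ a_n(x)`. [cite: FitznerVanDerHofstad2016NoBLE, §5.3.1 pp. 1096–1097] -/
theorem card_sawWordsTo_le_card_trailWordsTo (d n : ℕ) (x : Site d) :
    (sawWordsTo d n x).card ≤ (trailWordsTo d n x).card :=
  Finset.card_le_card (sawWordsTo_subset_trailWordsTo d n x)

/-- **`a_n(x) ≤ b_n(x)`**. [cite: FitznerVanDerHofstad2016NoBLE, §5.3.1 pp. 1096–1097] -/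
theorem card_trailWordsTo_le_card_nbwWordsTo (d n : ℕ) (x : Site d) :
    (trailWordsTo d n x).card ≤ (nbwWordsTo d n x).card :=
  Finset.card_le_card (trailWordsTo_subset_nbwWordsTo d n x)

/-- `a_n ≤ 2d (2d-1)^{n-1}` (`n ≥ 1`). [cite: MadrasSlade1993, §1.2 (c_{N,2} = 2d(2d-1)^{N-1})] -/
theorem card_trailWords_le (d : ℕ) {n : ℕ} (hn : 1 ≤ n) :
    (trailWords d n).card ≤ 2 * d * (2 * d - 1) ^ (n - 1) :=
  (Finset.card_le_card (trailWords_subset_nbwWords d n)).trans (card_nbwWords_le d hn)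

/-- A trail of length `n` traverses exactly `n` distinct bonds. [folklore] -/
theorem IsTrail.card_wordEdges {n : ℕ} {w : Fin n → Fin d × Bool} (h : IsTrail w) :
    (wordEdges w).card = n := by
  rw [wordEdges, Finset.card_image_of_injOn, Finset.card_range]
  intro i hi j hj hij
  exact h i j (Finset.mem_range.1 hi) (Finset.mem_range.1 hj) hij

/-- Conversely, a word of length `n` with `n` distinct traversed bonds is a trail. [folklore] -/
theorem isTrail_of_card_wordEdges {n : ℕ} {w : Fin n → Fin d × Bool} (h : (wordEdges w).card = n) :
    IsTrail w := by
  intro i j hi hj hij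
  have hinj : Set.InjOn (fun k => s(wordPos w k, wordPos w (k + 1))) ↑(Finset.range n) := by
    apply Finset.injOn_of_card_image_eq
    rw [Finset.card_range]
    exact h
  exact hinj (Finset.mem_coe.2 (Finset.mem_range.2 hi)) (Finset.mem_coe.2 (Finset.mem_range.2 hj)) hij

end Literature.Probability.FitznerVanDerHofstad2017
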